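import Literature.AlgebraicGeometry.Resolution.AlterationsFormalNodesRegular
import Literature.AlgebraicGeometry.Resolution.AlterationsCodimThreeNodalFormParts
import Literature.AlgebraicGeometry.Resolution.AlterationsSingularComponents
import Literature.AlgebraicGeometry.Resolution.AlterationsSemiStableNodeStructure
import Literature.AlgebraicGeometry.Resolution.SemiStableFibreDimension
import HarnessLib

/-!
# De Jong's alteration theorem: the presentation 3.3 at the singular closed points from the split
# nodal structure ("`Σ nᵢ ≥ 2`", and `dim 𝒪_{Y,f x} = d - 1`)

Topic: `Literature/AlgebraicGeometry/Resolution`. Two renderings of de Jong 1996, 3.3 (split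
case at a closed point, with Cohen's theorem for the base) now live in the Literature:

* `DeJong1996SplitNodalStructure` (`AlterationsFormalNodes.lean`, the owning unit of 4.24): at
  every closed point `x` at which `f` is not smooth, for every regular system of parameters `t`
  of `𝒪_{Y,f x}` adapted to `D`, `𝒪̂_{X,x} ≅ k⟦u, v, T₁, …, T_m⟧/(uv - ∏ Tᵢ^{νᵢ})`
  (`DeJong1996.FormalNodeRing k m ν`, `m = dim 𝒪_{Y,f x}`) with `f^#(tᵢ) ↦ Tᵢ`;
* `DeJong1996SemiStableNodalPresentation` (`AlterationsCodimThreeNodalFormParts.lean`, the unit of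
  3.5 [B3]): at every closed point `x` with `𝒪_{X,x}` NOT regular, for SOME such `t` indexed by
  `Fin (d - 1)`, `d = dim X`, the same presentation (`DeJong1996.NodalPowRing k (d - 1) nn`, the
  same ring under another name) with moreover `Σ nnᵢ ≥ 2`.

This file PROVES the second from the first
(`DeJong1996SemiStableNodalPresentation.of_splitNodalStructure`), i.e. the two printed remarks
that separate them:

* **"(if `Σ nᵢ = 1`, then the point `x` is regular on `X`)"** (3.3, p. 63): for `ν = δ_{i₀}` the
  formal node ring `k⟦u, v, T⟧/(uv - T_{i₀})` has its maximal ideal generated by the `m + 1`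
  elements `u, v, Tᵢ (i ≠ i₀)`, so it is regular as soon as its dimension is `≥ m + 1`
  (`DeJong1996.FormalNodeRing.isRegularLocalRing_of_single`); and a Noetherian local ring with
  regular completion is regular (`isRegularLocalRing_of_adicCompletion_equiv`). As `Σ νᵢ ≥ 1`
  (the completion is non-zero), non-regularity of `𝒪_{X,x}` forces `Σ νᵢ ≥ 2`.
* **`dim 𝒪_{Y,f x} = d - 1`** ("`t₁, …, t_{d-1}`", 4.25 (ii)): `dim 𝒪̂_{X,x} = dim 𝒪_{X,x} = d`
  at the closed point `x` of the `d`-dimensional variety `X`; `dim k⟦u, v, T₁, …, T_m⟧/(g) ≤ m + 1`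
  (`FormalNodeRing.ringKrullDim_le`); and `dim 𝒪_{X,x} ≥ dim 𝒪_{Y,f x} + 1` by the dimension
  formula for the flat `f` (EGA IV₂ 6.1.2) and the positive dimension of the local ring of the
  fibre — a curve with at most ordinary double points — at its closed point `x`
  (`DeJong1996.SemiStablePair.ringKrullDim_stalk_base_add_one_le`).

It also records that the two model rings agree definitionally
(`DeJong1996.nodalPowRing_eq_formalNodeRing`). With
`DeJong1996CodimThreeNodalForm.of_presentation_of_boundary_of_exponents` this leaves, below [B3],
the two facts `DeJong1996SemiStableNodalBoundary` and `DeJong1996CodimThreeExponentsLeOne` of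
`AlterationsCodimThreeNodalFormParts.lean` and the split nodal structure.

## Sources

* A. J. de Jong, *Smoothness, semi-stability and alterations*, Publ. Math. IHÉS 83 (1996), 2.21,
  2.23, 3.3 (pp. 61–63), 4.24–4.25 (p. 75).
* A. Grothendieck, J. Dieudonné, *EGA IV₂*, Cor. (6.1.2) (dimension formula for flat local
  homomorphisms), via `Literature.AlgebraicGeometry.Motives.coheight_eq_coheight_add_ringKrullDim_stalk_fiber`.
* H. Matsumura, *Commutative Ring Theory* (1986), §19 p. 158 (a Noetherian local ring is regular
  iff its completion is), via `AlterationsSingularComponents.lean`.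
-/

noncomputable section

open CategoryTheory CategoryTheory.Limits AlgebraicGeometry TopologicalSpace Topology
  IsLocalRing Order

namespace Literature.AlgebraicGeometry.Resolution

universe u

open Scheme.IdealSheafData

/-! ## The two model rings agree -/

namespace DeJong1996

/-- The relation `uv - ∏ tᵢ^{nnᵢ}` of `AlterationsCodimThreeNodalFormParts.lean` is the relation
`formalNodeRelation` of `AlterationsFormalNodes.lean`. [folklore] -/
theorem nodalRelationPow_eq_formalNodeRelation (k : Type u) [Field k] (m : ℕ) (nn : Fin m → ℕ) :
    nodalRelationPow k m nn = formalNodeRelation k m nn := rfl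

/-- Accordingly `NodalPowRing k m nn` and `FormalNodeRing k m nn` are the same ring. [folklore] -/
theorem nodalPowRing_eq_formalNodeRing (k : Type u) [Field k] (m : ℕ) (nn : Fin m → ℕ) :
    NodalPowRing k m nn = FormalNodeRing k m nn := rfl

/-! ## "If `Σ nᵢ = 1`, then the point `x` is regular": the formal node ring with `ν = δ_{i₀}` -/

namespace FormalNodeRing

variable (k : Type u) [Field k]

/-- For `ν = δ_{i₀}` the class of `T_{i₀}` is `uv`. [cite: DeJong1996, 3.3, p. 63] -/
theorem mk_X_inr_eq_mul_of_single {m : ℕ} (i₀ : Fin m) :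
    Ideal.Quotient.mk (Ideal.span {formalNodeRelation k m (Pi.single i₀ 1)})
        (MvPowerSeries.X (Sum.inr i₀)) =
      Ideal.Quotient.mk (Ideal.span {formalNodeRelation k m (Pi.single i₀ 1)})
          (MvPowerSeries.X (Sum.inl 0)) *
        Ideal.Quotient.mk (Ideal.span {formalNodeRelation k m (Pi.single i₀ 1)})
          (MvPowerSeries.X (Sum.inl 1)) := by
  rw [mk_X_mul_X]
  congr 1
  rw [Finset.prod_eq_single i₀ (fun i _ hi => by rw [Pi.single_apply, if_neg hi, pow_zero])
    (fun h => (h (Finset.mem_univ _)).elim), Pi.single_eq_same, pow_one]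

/-- If some `νᵢ ≥ 1`, the maximal ideal of the formal node ring is generated by the classes of
`u`, `v` and the `Tᵢ` (`maximalIdeal_eq_span`, regrouped). [folklore] -/
theorem maximalIdeal_eq_span_union {m : ℕ} {ν : Fin m → ℕ} (hν : ∃ i, ν i ≠ 0) :
    haveI := isLocalRing k m hν
    maximalIdeal (FormalNodeRing k m ν) =
      Ideal.span ({Ideal.Quotient.mk (Ideal.span {formalNodeRelation k m ν})
          (MvPowerSeries.X (Sum.inl 0)),
        Ideal.Quotient.mk (Ideal.span {formalNodeRelation k m ν}) (MvPowerSeries.X (Sum.inl 1))} ∪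
        Set.range fun i : Fin m =>
          Ideal.Quotient.mk (Ideal.span {formalNodeRelation k m ν}) (MvPowerSeries.X (Sum.inr i))) := by
  rw [maximalIdeal_eq_span k m hν]
  congr 1
  ext y
  simp only [Set.mem_union, Set.mem_insert_iff, Set.mem_singleton_iff, Set.mem_range]
  constructor
  · rintro ⟨j, rfl⟩
    rcases j with j | i
    · fin_cases j
      · exact Or.inl (Or.inl rfl)
      · exact Or.inl (Or.inr rfl)
    · exact Or.inr ⟨i, rfl⟩
  · rintro ((rfl | rfl) | ⟨i, rfl⟩)
    · exact ⟨Sum.inl 0, rfl⟩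
    · exact ⟨Sum.inl 1, rfl⟩
    · exact ⟨Sum.inr i, rfl⟩

/-- **"If `Σ nᵢ = 1`, then the point `x` is regular on `X`"** (de Jong 1996, 3.3): for
`ν = δ_{i₀}` the formal node ring `k⟦u, v, T₀, …, T_m⟧/(uv - T_{i₀})` has maximal ideal generated
by the `m + 2` elements `u, v, Tᵢ (i ≠ i₀)`; hence a Noetherian local ring `R` of dimension
`≥ m + 2` isomorphic to it is regular (Krull: `dim R ≤ emb dim R ≤ m + 2`).
[cite: DeJong1996, 3.3, p. 63] -/
theorem isRegularLocalRing_of_single {R : Type*} [CommRing R] [IsLocalRing R] [IsNoetherianRing R]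
    {m : ℕ} (i₀ : Fin (m + 1)) (e : R ≃+* FormalNodeRing k (m + 1) (Pi.single i₀ 1))
    (hdim : ((m + 2 : ℕ) : WithBot ℕ∞) ≤ ringKrullDim R) : IsRegularLocalRing R := by
  classical
  have hν : ∃ i, (Pi.single i₀ 1 : Fin (m + 1) → ℕ) i ≠ 0 :=
    ⟨i₀, by rw [Pi.single_eq_same]; exact one_ne_zero⟩
  haveI := isLocalRing k (m + 1) hν
  set mk := Ideal.Quotient.mk (Ideal.span {formalNodeRelation k (m + 1) (Pi.single i₀ 1)})
    with hmk
  set a := mk (MvPowerSeries.X (Sum.inl 0)) with ha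
  set b := mk (MvPowerSeries.X (Sum.inl 1)) with hb
  set c : Fin (m + 1) → FormalNodeRing k (m + 1) (Pi.single i₀ 1) := fun i =>
    mk (MvPowerSeries.X (Sum.inr i)) with hc
  have hci₀ : c i₀ ∈ Ideal.span {a} := by
    have h : c i₀ = a * b := mk_X_inr_eq_mul_of_single k i₀
    rw [h]
    exact Ideal.mul_mem_right b _ (Ideal.mem_span_singleton_self a)
  -- `𝔪 = (a, b, c ∘ succAbove i₀)`, `m + 2` generators
  set w : Fin (m + 2) → FormalNodeRing k (m + 1) (Pi.single i₀ 1) :=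
    Fin.cons a (Fin.cons b (c ∘ i₀.succAbove)) with hw
  have hmax : maximalIdeal (FormalNodeRing k (m + 1) (Pi.single i₀ 1)) =
      Ideal.span (Set.range w) := by
    rw [hw, Ideal.span_range_node_eq a b c i₀ hci₀, maximalIdeal_eq_span_union k hν]
  have hfin : ((maximalIdeal (FormalNodeRing k (m + 1) (Pi.single i₀ 1))).spanFinrank : WithBot ℕ∞)
      ≤ (m + 2 : ℕ) := by
    have h1 : (Ideal.span (Set.range w)).spanFinrank ≤ (Set.range w).ncard :=
      Submodule.spanFinrank_span_le_ncard_of_finite (Set.finite_range w)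
    have h2 : (Set.range w).ncard ≤ m + 2 := by
      rw [← Set.image_univ]
      refine (Set.ncard_image_le (Set.finite_univ)).trans ?_
      rw [Set.ncard_univ, Nat.card_eq_fintype_card, Fintype.card_fin]
    rw [hmax]
    exact_mod_cast h1.trans h2
  -- transport to `R`
  haveI hM : IsNoetherianRing (FormalNodeRing k (m + 1) (Pi.single i₀ 1)) :=
    isNoetherianRing_of_ringEquiv R e
  have hregM : IsRegularLocalRing (FormalNodeRing k (m + 1) (Pi.single i₀ 1)) := by
    refine IsRegularLocalRing.of_spanFinrank_maximalIdeal_le _ (hfin.trans ?_)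
    rwa [← ringKrullDim_eq_of_ringEquiv e]
  exact IsRegularLocalRing.of_ringEquiv e.symm

/-- The exponents of a formal node ring: if some `νᵢ ≠ 0` and `Σ νᵢ ≤ 1` then `ν = δ_{i₀}`.
[folklore] -/
theorem eq_single_of_sum_le_one {m : ℕ} {ν : Fin m → ℕ} (hν : ∃ i, ν i ≠ 0)
    (hsum : ∑ i, ν i ≤ 1) : ∃ i₀, ν = Pi.single i₀ 1 := by
  classical
  obtain ⟨i₀, hi₀⟩ := hν
  refine ⟨i₀, funext fun i => ?_⟩
  have hle : ∀ j, ν j ≤ ∑ i, ν i := fun j =>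
    Finset.single_le_sum (fun i _ => Nat.zero_le (ν i)) (Finset.mem_univ j)
  have h1 : ν i₀ = 1 := by have := hle i₀; omega
  by_cases hi : i = i₀
  · subst hi
    rw [Pi.single_eq_same, h1]
  · rw [Pi.single_apply, if_neg hi]
    have hsplit := Finset.add_sum_erase Finset.univ ν (Finset.mem_univ i₀)
    have hrest : ∑ j ∈ Finset.univ.erase i₀, ν j = 0 := by omega
    exact Finset.sum_eq_zero_iff.mp hrest i (Finset.mem_erase.mpr ⟨hi, Finset.mem_univ i⟩)

end FormalNodeRing

/-! ## `dim 𝒪_{X,x} ≥ dim 𝒪_{Y,f x} + 1` at a closed point -/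

namespace SemiStablePair

variable {k : Type u} [Field k] {X Y : Scheme.{u}} {f : X ⟶ Y} {g : Y ⟶ Spec (.of k)}
  {D : Set Y} {n : ℕ} {τ : Fin n → (Y ⟶ X)}

/-- In Situation 4.23 over an algebraically closed field, at a closed point `x` the local ring of
the fibre `X_{f x}` at `x` has dimension `≥ 1`: `f x` is closed with algebraically closed residue
field, so `X_{f x}` is a geometric fibre of the semi-stable curve, and its closed point `x` is a
nonsingular point of a curve (dimension `1`) or an ordinary double point (dimension `≥ 1`,
`IsOrdinaryDoublePoint.one_le_ringKrullDim`). [cite: DeJong1996, 2.21, p. 61] -/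
theorem one_le_ringKrullDim_stalk_fiber [IsAlgClosed k] (hS : SemiStablePair f g D τ) {x : X}
    (hx : IsClosed ({x} : Set X)) :
    1 ≤ ringKrullDim ((f.fiber (f x)).presheaf.stalk (f.asFiber x)) := by
  haveI := hS.isSemiStableCurve.isProper
  haveI := hS.isSemiStableCurve.locallyOfFinitePresentation
  have hy : IsClosed ({f x} : Set Y) := by
    rw [← Set.image_singleton]
    exact f.isClosedMap _ hx
  haveI : IsProper g :=
    Literature.AlgebraicGeometry.Motives.IsProjectiveOver.isProper (X := Over.mk g)
      hS.isProjectiveOver_base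
  haveI : IsAlgClosed (Y.residueField (f x)) :=
    IsAlgClosed.of_ringEquiv k _ (residueFieldIsoBase g (f x) hy).commRingCatIsoToRingEquiv.symm
  -- the fibre is locally Noetherian
  haveI : LocallyOfFiniteType (f.fiberToSpecResidueField (f x)) :=
    MorphismProperty.pullback_snd _ _ inferInstance
  haveI : IsLocallyNoetherian (f.fiber (f x)) :=
    LocallyOfFiniteType.isLocallyNoetherian (f.fiberToSpecResidueField (f x))
  -- the point of the fibre over `x` is closed
  have hx' : IsClosed ({f.asFiber x} : Set ↥(f.fiber (f x))) := by
    have e : ({f.asFiber x} : Set ↥(f.fiber (f x))) = f.fiberι (f x) ⁻¹' {x} := by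
      ext z
      simp only [Set.mem_singleton_iff, Set.mem_preimage]
      constructor
      · rintro rfl
        exact f.fiberι_asFiber x
      · intro hz
        apply (f.fiberι (f x)).isEmbedding.injective
        rw [hz, f.fiberι_asFiber]
    rw [e]
    exact hx.preimage (f.fiberι (f x)).continuous
  rcases hS.isSemiStableCurve.isRegularLocalRing_or_isOrdinaryDoublePoint (Y.residueField (f x))
      (Y.fromSpecResidueField (f x)) (f.asFiber x) hx' with ⟨-, hdim⟩ | hnode
  · exact hdim.ge
  · exact IsOrdinaryDoublePoint.one_le_ringKrullDim (Y.residueField (f x)) hnode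

/-- **`dim 𝒪_{X,x} ≥ dim 𝒪_{Y,f(x)} + 1` at a closed point of the curve of Situation 4.23** (EGA
IV₂ 6.1.2, the dimension formula for the flat `f`: `dim 𝒪_{X,x} = dim 𝒪_{Y,f x} + dim 𝒪_{X_{f x},x}`,
and `one_le_ringKrullDim_stalk_fiber`). [cite: GrothendieckDieudonne1965, Cor. (6.1.2), p. 135] -/
theorem ringKrullDim_stalk_base_add_one_le [IsAlgClosed k] (hS : SemiStablePair f g D τ) {x : X}
    (hx : IsClosed ({x} : Set X)) :
    ringKrullDim (Y.presheaf.stalk (f x)) + 1 ≤ ringKrullDim (X.presheaf.stalk x) := by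
  haveI := hS.isNoetherian
  haveI := hS.isNoetherian_base
  haveI := hS.isSemiStableCurve.flat
  have h := Literature.AlgebraicGeometry.Motives.coheight_eq_coheight_add_ringKrullDim_stalk_fiber f x
  rw [ringKrullDim_stalk_eq_coheight, ringKrullDim_stalk_eq_coheight, h]
  exact add_le_add (le_refl _) (hS.one_le_ringKrullDim_stalk_fiber hx)

/-- **`dim 𝒪_{Y,f x} + 1 = dim 𝒪_{X,x}` at a closed point of `Sing(f)`** given the split nodal
structure there: `dim 𝒪_{X,x} = dim 𝒪̂_{X,x} = dim k⟦u, v, T₁, …, T_m⟧/(g) ≤ m + 1 = dim 𝒪_{Y,f x} + 1`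
(`FormalNodeRing.ringKrullDim_le`) and `ringKrullDim_stalk_base_add_one_le`.
[cite: DeJong1996, 3.3, p. 63] -/
theorem ringKrullDim_stalk_eq_of_formalNodeRing [IsAlgClosed k] (hS : SemiStablePair f g D τ)
    {x : X} (hx : IsClosed ({x} : Set X)) {m : ℕ} {ν : Fin m → ℕ}
    (hm : ringKrullDim (Y.presheaf.stalk (f x)) = m)
    (e : AdicCompletion (maximalIdeal (X.presheaf.stalk x)) (X.presheaf.stalk x) ≃+*
      FormalNodeRing k m ν) :
    ringKrullDim (X.presheaf.stalk x) = (m + 1 : ℕ) := by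
  haveI := hS.isNoetherian
  refine le_antisymm ?_ ?_
  · rw [← ringKrullDim_adicCompletion, ringKrullDim_eq_of_ringEquiv e]
    exact FormalNodeRing.ringKrullDim_le k m ν
  · have h := hS.ringKrullDim_stalk_base_add_one_le hx
    rw [hm] at h
    exact_mod_cast h

end SemiStablePair

end DeJong1996

/-! ## The presentation of 3.3 at the singular closed points from the split nodal structure -/

/-- **`DeJong1996SemiStableNodalPresentation` from `DeJong1996SplitNodalStructure`.** At a
closed point `x` with `𝒪_{X,x}` not regular, `f` is not smooth (3.1), so the split nodal
structure applies to a regular system of parameters `t₁, …, t_m` of `𝒪_{Y,f x}` adapted to `D`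
(`exists_rsop_stalkIdeal_base'`); `m + 1 = d` (`ringKrullDim_stalk_eq_of_formalNodeRing`), and
`Σ νᵢ ≥ 2` — `Σ νᵢ ≥ 1` as the completion is non-zero, and `Σ νᵢ = 1` would make `𝒪̂_{X,x}`,
hence `𝒪_{X,x}`, regular ("if `Σ nᵢ = 1`, then the point `x` is regular on `X`",
`FormalNodeRing.isRegularLocalRing_of_single`). [cite: DeJong1996, 3.3, p. 63] -/
theorem DeJong1996SemiStableNodalPresentation.of_splitNodalStructure
    (hN : DeJong1996SplitNodalStructure.{u}) : DeJong1996SemiStableNodalPresentation.{u} := by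
  intro k _ _ X Y f g D n τ d hS hd x hx hreg
  classical
  haveI := hS.isIntegral
  haveI := hS.locallyOfFiniteType
  haveI := hS.isNoetherian
  have hns : ∀ U : X.Opens, x ∈ U → ¬ Smooth (U.ι ≫ f) :=
    hS.not_smooth_of_not_isRegularLocalRing hreg
  have hxD : f x ∈ D := hS.apply_mem_of_not_isRegularLocalRing hreg
  -- the base parameters and the split nodal structure
  obtain ⟨m, ρ, t, hρm, hdimA, hspanA, hIA, hρ⟩ := hS.exists_rsop_stalkIdeal_base' (f x)
  have hρ1 : 1 ≤ ρ := hρ hxD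
  obtain ⟨ν, e, hν, he⟩ := hN k X Y f g D n τ hS x hx hns m ρ t hspanA hdimA hρm hIA
  -- `d = m + 1`
  have hdimB : ringKrullDim (X.presheaf.stalk x) = (m + 1 : ℕ) :=
    hS.ringKrullDim_stalk_eq_of_formalNodeRing hx hdimA e
  have hd' : ringKrullDim (X.presheaf.stalk x) = d := by
    rw [ringKrullDim_stalk_eq_of_isClosed (f ≫ g) hx, hd]
  obtain rfl : d = m + 1 := by
    rw [hdimB] at hd'
    exact_mod_cast hd'.symm
  -- `Σ νᵢ ≥ 2`
  have hν0 : ∃ i, ν i ≠ 0 := DeJong1996.FormalNodeRing.exists_ne_zero_of_ringEquiv e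
  have hsum : 2 ≤ ∑ i, ν i := by
    by_contra hlt
    obtain ⟨i₀, hi₀⟩ := DeJong1996.FormalNodeRing.eq_single_of_sum_le_one hν0 (by omega)
    obtain ⟨m, rfl⟩ : ∃ m', m = m' + 1 := ⟨m - 1, by have := i₀.isLt; omega⟩
    subst hi₀
    haveI := isNoetherianRing_adicCompletion_maximalIdeal (X.presheaf.stalk x)
    haveI : IsRegularLocalRing (AdicCompletion (maximalIdeal (X.presheaf.stalk x))
        (X.presheaf.stalk x)) :=
      DeJong1996.FormalNodeRing.isRegularLocalRing_of_single k i₀ e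
        (by rw [ringKrullDim_adicCompletion, hdimB])
    exact hreg (isRegularLocalRing_of_adicCompletion_equiv rfl (RingEquiv.refl _))
  -- conclusion (`d - 1 = m` definitionally)
  exact ⟨ρ, t, ν, hρ1, hρm, hspanA, hIA, hν, hsum, e, he⟩

/-- **[B3] from the split nodal structure, the boundary, and "`nᵢ ∈ {0, 1}`"**: with
`DeJong1996CodimThreeNodalForm.of_presentation_of_boundary_of_exponents`.
[cite: DeJong1996, 3.5, p. 64] -/
theorem DeJong1996CodimThreeNodalForm.of_splitNodal_of_boundary_of_exponents
    (hN : DeJong1996SplitNodalStructure.{u}) (h₁' : DeJong1996SemiStableNodalBoundary.{u})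
    (h₂ : DeJong1996CodimThreeExponentsLeOne.{u}) : DeJong1996CodimThreeNodalForm.{u} :=
  DeJong1996CodimThreeNodalForm.of_presentation_of_boundary_of_exponents
    (DeJong1996SemiStableNodalPresentation.of_splitNodalStructure hN) h₁' h₂

/-- The target of the owning unit, 4.24 in sufficiency form (`DeJong1996SemiStablePairNormalForm`),
from the leaves as of this file: Lemma 3.2 as printed, the split nodal structure 2.23/3.3, the
boundary and the exponent bound of 3.5, and the formal structure of the singular components
(`DeJong1996CodimThreeSingularComponentsFormal`, `AlterationsSingularComponents.lean`).
[cite: DeJong1996, 4.24, p. 75] -/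
theorem DeJong1996SemiStablePairNormalForm.of_lemma32_of_splitNodal_of_boundary_of_exponents_of_formal
    (hA : DeJong1996Lemma32.{u}) (hN : DeJong1996SplitNodalStructure.{u})
    (h₁' : DeJong1996SemiStableNodalBoundary.{u}) (h₂ : DeJong1996CodimThreeExponentsLeOne.{u})
    (h₅ : DeJong1996CodimThreeSingularComponentsFormal.{u}) :
    DeJong1996SemiStablePairNormalForm.{u} :=
  DeJong1996SemiStablePairNormalForm.of_lemma32_of_splitNodal_of_nodal_of_components hA hN
    (DeJong1996CodimThreeNodalForm.of_splitNodal_of_boundary_of_exponents hN h₁' h₂)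
    (DeJong1996CodimThreeSingularComponentsRegular.of_formal h₅)

end Literature.AlgebraicGeometry.Resolution

end
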